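import Mathlib
import Summits.ValiantsHypothesis.ValiantsHypothesis.Theorems.KPlusLogSqLawStepTerminal

/-!
# The CONTINUATION LAW, mirror images (static path model behind `KPlusLogSqLaw.TropicalB`)

Cell pub-symmetroid, seat conjb-2 (g21). A helper toward the crux `TropicalB`
(`Summit.ValiantsHypothesis.ValiantsHypothesis.Theses.KPlusLogSqLaw.TropicalB`, item
`stmt-ValiantsHypothesis-19771`); it earns no crux credit and is not evidence for `MatrixDescartes` or for
Valiant's hypothesis.

`KPlusLogSqLawStepTerminal` proves the CONTINUATION LAW (THEORY-NOTE-g21 §3.1ter: a step away from the natural side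
of its row is the last step of its plateau) for rows whose natural side is on the left. This file transports it
along `θ ↦ -θ` (slopes negated, separation sets reflected) to rows whose natural side is on the RIGHT:
`away_step_terminal_even_mirror` (`i` even, `s i < s (i+1)`, i.e. `λ_i < 0`, step moving left) and
`away_step_terminal_odd_mirror` (`i` odd, `s (i+1) < s i`, step moving left). Together the four statements say: if
rows `i` and `i+1` both step (reach `d` odd), then the step at row `i` moves toward the natural side of row `i`.
-/

set_option linter.dupNamespace false

namespace Summit.ValiantsHypothesis.ValiantsHypothesis.Theorems.KPlusLogSqLawStepTerminalMirror

open Summit.ValiantsHypothesis.ValiantsHypothesis.Theorems.KPlusLogSqLawStepTerminal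
  (away_step_terminal_even away_step_terminal_odd)

/-- CONTINUATION LAW, even first line with natural side on the right (`s i < s (i+1)`, i.e. `λ_i < 0`): if the
step at row `i` moves left, row `i+1` does not step. -/
theorem away_step_terminal_even_mirror (s b : ℕ → ℝ) (i d : ℕ) (hi : Even i) (hd : Odd d) (hnat : s i < s (i + 1))
    (hA : ∃ θ : ℝ, ∀ e o : ℕ, i ≤ e → e ≤ i + d → i ≤ o → o ≤ i + d → Even e → Odd o →
      b o + s o * θ < b e + s e * θ)
    (hB : ∃ θ : ℝ, ∀ e o : ℕ, i + 1 ≤ e → e ≤ i + d + 1 → i + 1 ≤ o → o ≤ i + d + 1 → Even e → Odd o →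
      b o + s o * θ < b e + s e * θ)
    (hAB : ∀ θ : ℝ, ¬ ((∀ e o : ℕ, i ≤ e → e ≤ i + d → i ≤ o → o ≤ i + d → Even e → Odd o →
      b o + s o * θ < b e + s e * θ) ∧ (∀ e o : ℕ, i + 1 ≤ e → e ≤ i + d + 1 → i + 1 ≤ o → o ≤ i + d + 1 →
      Even e → Odd o → b o + s o * θ < b e + s e * θ)))
    (hord : ∀ θ θ' : ℝ, (∀ e o : ℕ, i ≤ e → e ≤ i + d → i ≤ o → o ≤ i + d → Even e → Odd o →
      b o + s o * θ < b e + s e * θ) → (∀ e o : ℕ, i + 1 ≤ e → e ≤ i + d + 1 → i + 1 ≤ o → o ≤ i + d + 1 →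
      Even e → Odd o → b o + s o * θ' < b e + s e * θ') → θ' < θ)
    (hB' : ∃ θ : ℝ, ∀ e o : ℕ, i + 2 ≤ e → e ≤ i + d + 2 → i + 2 ≤ o → o ≤ i + d + 2 → Even e → Odd o →
      b o + s o * θ < b e + s e * θ) :
    ∃ θ : ℝ, (∀ e o : ℕ, i + 1 ≤ e → e ≤ i + d + 1 → i + 1 ≤ o → o ≤ i + d + 1 → Even e → Odd o →
      b o + s o * θ < b e + s e * θ) ∧ (∀ e o : ℕ, i + 2 ≤ e → e ≤ i + d + 2 → i + 2 ≤ o → o ≤ i + d + 2 →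
      Even e → Odd o → b o + s o * θ < b e + s e * θ) := by
  obtain ⟨θA, hθA⟩ := hA
  obtain ⟨θB, hθB⟩ := hB
  obtain ⟨θB', hθB'⟩ := hB'
  -- reflect: slopes `-s`, parameter `-θ`
  obtain ⟨θ, h1, h2⟩ := away_step_terminal_even (fun t => - s t) b i d hi hd (neg_lt_neg hnat)
    ⟨-θA, fun e o g1 g2 g3 g4 he ho => by
      have := hθA e o g1 g2 g3 g4 he ho
      have r1 : -s o * -θA = s o * θA := by ring
      have r2 : -s e * -θA = s e * θA := by ring
      linarith⟩
    ⟨-θB, fun e o g1 g2 g3 g4 he ho => by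
      have := hθB e o g1 g2 g3 g4 he ho
      have r1 : -s o * -θB = s o * θB := by ring
      have r2 : -s e * -θB = s e * θB := by ring
      linarith⟩
    (fun θ hθ => hAB (-θ)
      ⟨fun e o g1 g2 g3 g4 he ho => by
        have := hθ.1 e o g1 g2 g3 g4 he ho
        have r1 : s o * -θ = -s o * θ := by ring
        have r2 : s e * -θ = -s e * θ := by ring
        linarith,
       fun e o g1 g2 g3 g4 he ho => by
        have := hθ.2 e o g1 g2 g3 g4 he ho
        have r1 : s o * -θ = -s o * θ := by ring
        have r2 : s e * -θ = -s e * θ := by ring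
        linarith⟩)
    (fun θ θ' hθ hθ' => by
      have := hord (-θ) (-θ')
        (fun e o g1 g2 g3 g4 he ho => by
          have := hθ e o g1 g2 g3 g4 he ho
          have r1 : s o * -θ = -s o * θ := by ring
          have r2 : s e * -θ = -s e * θ := by ring
          linarith)
        (fun e o g1 g2 g3 g4 he ho => by
          have := hθ' e o g1 g2 g3 g4 he ho
          have r1 : s o * -θ' = -s o * θ' := by ring
          have r2 : s e * -θ' = -s e * θ' := by ring
          linarith)
      linarith)
    ⟨-θB', fun e o g1 g2 g3 g4 he ho => by
      have := hθB' e o g1 g2 g3 g4 he ho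
      have r1 : -s o * -θB' = s o * θB' := by ring
      have r2 : -s e * -θB' = s e * θB' := by ring
      linarith⟩
  refine ⟨-θ, fun e o g1 g2 g3 g4 he ho => ?_, fun e o g1 g2 g3 g4 he ho => ?_⟩
  · have := h1 e o g1 g2 g3 g4 he ho
    have r1 : s o * -θ = -s o * θ := by ring
    have r2 : s e * -θ = -s e * θ := by ring
    linarith
  · have := h2 e o g1 g2 g3 g4 he ho
    have r1 : s o * -θ = -s o * θ := by ring
    have r2 : s e * -θ = -s e * θ := by ring
    linarith

/-- CONTINUATION LAW, odd first line with natural side on the right (`s (i+1) < s i`, i.e. `λ_i < 0`): if the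
step at row `i` moves left, row `i+1` does not step. -/
theorem away_step_terminal_odd_mirror (s b : ℕ → ℝ) (i d : ℕ) (hi : Odd i) (hd : Odd d) (hnat : s (i + 1) < s i)
    (hA : ∃ θ : ℝ, ∀ e o : ℕ, i ≤ e → e ≤ i + d → i ≤ o → o ≤ i + d → Even e → Odd o →
      b o + s o * θ < b e + s e * θ)
    (hB : ∃ θ : ℝ, ∀ e o : ℕ, i + 1 ≤ e → e ≤ i + d + 1 → i + 1 ≤ o → o ≤ i + d + 1 → Even e → Odd o →
      b o + s o * θ < b e + s e * θ)
    (hAB : ∀ θ : ℝ, ¬ ((∀ e o : ℕ, i ≤ e → e ≤ i + d → i ≤ o → o ≤ i + d → Even e → Odd o →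
      b o + s o * θ < b e + s e * θ) ∧ (∀ e o : ℕ, i + 1 ≤ e → e ≤ i + d + 1 → i + 1 ≤ o → o ≤ i + d + 1 →
      Even e → Odd o → b o + s o * θ < b e + s e * θ)))
    (hord : ∀ θ θ' : ℝ, (∀ e o : ℕ, i ≤ e → e ≤ i + d → i ≤ o → o ≤ i + d → Even e → Odd o →
      b o + s o * θ < b e + s e * θ) → (∀ e o : ℕ, i + 1 ≤ e → e ≤ i + d + 1 → i + 1 ≤ o → o ≤ i + d + 1 →
      Even e → Odd o → b o + s o * θ' < b e + s e * θ') → θ' < θ)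
    (hB' : ∃ θ : ℝ, ∀ e o : ℕ, i + 2 ≤ e → e ≤ i + d + 2 → i + 2 ≤ o → o ≤ i + d + 2 → Even e → Odd o →
      b o + s o * θ < b e + s e * θ) :
    ∃ θ : ℝ, (∀ e o : ℕ, i + 1 ≤ e → e ≤ i + d + 1 → i + 1 ≤ o → o ≤ i + d + 1 → Even e → Odd o →
      b o + s o * θ < b e + s e * θ) ∧ (∀ e o : ℕ, i + 2 ≤ e → e ≤ i + d + 2 → i + 2 ≤ o → o ≤ i + d + 2 →
      Even e → Odd o → b o + s o * θ < b e + s e * θ) := by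
  obtain ⟨θA, hθA⟩ := hA
  obtain ⟨θB, hθB⟩ := hB
  obtain ⟨θB', hθB'⟩ := hB'
  -- reflect: slopes `-s`, parameter `-θ`
  obtain ⟨θ, h1, h2⟩ := away_step_terminal_odd (fun t => - s t) b i d hi hd (neg_lt_neg hnat)
    ⟨-θA, fun e o g1 g2 g3 g4 he ho => by
      have := hθA e o g1 g2 g3 g4 he ho
      have r1 : -s o * -θA = s o * θA := by ring
      have r2 : -s e * -θA = s e * θA := by ring
      linarith⟩
    ⟨-θB, fun e o g1 g2 g3 g4 he ho => by
      have := hθB e o g1 g2 g3 g4 he ho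
      have r1 : -s o * -θB = s o * θB := by ring
      have r2 : -s e * -θB = s e * θB := by ring
      linarith⟩
    (fun θ hθ => hAB (-θ)
      ⟨fun e o g1 g2 g3 g4 he ho => by
        have := hθ.1 e o g1 g2 g3 g4 he ho
        have r1 : s o * -θ = -s o * θ := by ring
        have r2 : s e * -θ = -s e * θ := by ring
        linarith,
       fun e o g1 g2 g3 g4 he ho => by
        have := hθ.2 e o g1 g2 g3 g4 he ho
        have r1 : s o * -θ = -s o * θ := by ring
        have r2 : s e * -θ = -s e * θ := by ring
        linarith⟩)
    (fun θ θ' hθ hθ' => by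
      have := hord (-θ) (-θ')
        (fun e o g1 g2 g3 g4 he ho => by
          have := hθ e o g1 g2 g3 g4 he ho
          have r1 : s o * -θ = -s o * θ := by ring
          have r2 : s e * -θ = -s e * θ := by ring
          linarith)
        (fun e o g1 g2 g3 g4 he ho => by
          have := hθ' e o g1 g2 g3 g4 he ho
          have r1 : s o * -θ' = -s o * θ' := by ring
          have r2 : s e * -θ' = -s e * θ' := by ring
          linarith)
      linarith)
    ⟨-θB', fun e o g1 g2 g3 g4 he ho => by
      have := hθB' e o g1 g2 g3 g4 he ho
      have r1 : -s o * -θB' = s o * θB' := by ring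
      have r2 : -s e * -θB' = s e * θB' := by ring
      linarith⟩
  refine ⟨-θ, fun e o g1 g2 g3 g4 he ho => ?_, fun e o g1 g2 g3 g4 he ho => ?_⟩
  · have := h1 e o g1 g2 g3 g4 he ho
    have r1 : s o * -θ = -s o * θ := by ring
    have r2 : s e * -θ = -s e * θ := by ring
    linarith
  · have := h2 e o g1 g2 g3 g4 he ho
    have r1 : s o * -θ = -s o * θ := by ring
    have r2 : s e * -θ = -s e * θ := by ring
    linarith

end Summit.ValiantsHypothesis.ValiantsHypothesis.Theorems.KPlusLogSqLawStepTerminalMirror
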